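import Summits.HubbardSuperconductivity.HubbardSuperconductivity.Theorems.SoloBlindTrialSubspaceTransfer
import HarnessLib

/-!
# COVER from a degeneracy bound: the every-ground-state quantifier as a dimension count

In the primal (variational) form of the summit (`SoloBlindTrialSubspaceTransfer`: a trial
subspace `T` with d-wave ORDER, CLOSENESS of `T` to the ground eigenspace `V` of the doped
sector, and COVER `P_V T = V`), COVER — "no sector ground state is orthogonal to the trial
family", requirement R4 of the obstruction report — is the only hypothesis that is not a property
of the trial states alone. This file replaces it by a pure DEGENERACY COUNT: if `T` is metrically
`ε`-close to `V` with `ε < 1`, then `P_V` is injective on `T`, so `dim P_V T = dim T`, and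
`dim V ≤ dim T` forces `P_V T = V` (`cover_of_close_of_finrank_le`).

* `orthogonal_residual_le` — the orthogonal residual `φ - P_V φ` is the shortest one, so metric
  closeness implies the projection-free CLOSENESS used in `SoloBlindTrialSubspaceTransfer`.
* `cover_of_close_of_finrank_le` — metric closeness `ε < 1` + `finrank V ≤ finrank T` ⟹ COVER.
* `hubbardSuperconductivity_of_trialSubspaces_degeneracy` — THE SUMMIT follows from: for some
  `U > 0`, `δ ∈ (0,1/2)`, `c > 0`, `ε < 1` with `1600ε ≤ c`, and all large even `L`, a trial
  subspace `T_L` with (ORDER) `cL⁴‖φ‖² ≤ ‖√2Δ_d φ‖²` on `T_L`, (CLOSENESS) every `φ ∈ T_L` within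
  squared distance `ε‖φ‖²` of a ground state of the doped `S^z = 0` sector (or of `0`), and
  (DEGENERACY) every linearly independent family of sector ground states has at most
  `finrank T_L` members, i.e. `dim V_L ≤ dim T_L`.

Reading (R4 priced). Given good trial states, the every-ground-state quantifier of the summit
costs exactly an UPPER BOUND ON THE GROUND-STATE DEGENERACY of the doped `S^z = 0` sector by the
dimension of the trial family; with a single trial state per `L` it is NON-DEGENERACY of the
sector ground state, which no present method controls away from half filling (Lieb 1989 covers
half filling only). With `SoloBlindTrialSubspaceGap` (necessity) the count is also necessary:
`T_L = V_L` realises it with equality.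
References: Horn–Johnson, *Matrix Analysis* §0.4.4 (rank of a restriction), §4.3;
`Submodule.eq_of_le_of_finrank_le`, `Submodule.starProjection`.
-/

namespace Summit.HubbardSuperconductivity.HubbardSuperconductivity.Theorems

open Matrix Finset Literature.MathematicalPhysics.QuantumLattice
  Literature.MathematicalPhysics.QuantumFieldTheory GaugeTwist WithLp
open scoped ComplexConjugate ComplexOrder InnerProductSpace

section Abstract

variable {n : Type*} [Fintype n]

/-- The orthogonal residual is the shortest: if `u, ψ ∈ V` and `φ - u ⊥ V` then
`‖φ - u‖² ≤ ‖φ - ψ‖²` (Pythagoras). [folklore] -/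
theorem orthogonal_residual_le (V : Submodule ℂ (n → ℂ)) {φ u ψ : n → ℂ}
    (hu : u ∈ V) (hψ : ψ ∈ V) (horth : ∀ v ∈ V, star v ⬝ᵥ (φ - u) = 0) :
    (star (φ - u) ⬝ᵥ (φ - u)).re ≤ (star (φ - ψ) ⬝ᵥ (φ - ψ)).re := by
  have hsplit : φ - ψ = (φ - u) + (u - ψ) := by abel
  have h0 : (star (φ - u) ⬝ᵥ (u - ψ)).re = 0 := by
    rw [star_dotProduct, horth _ (V.sub_mem hu hψ), star_zero, Complex.zero_re]
  rw [hsplit, re_add_self_of_orthogonal _ _ h0]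
  exact le_add_of_nonneg_right (Complex.nonneg_iff.mp (dotProduct_star_self_nonneg _)).1

/-- **COVER from a degeneracy bound.** If every `φ ∈ T` is within squared distance `ε‖φ‖²` of
`V` with `ε < 1`, and `finrank V ≤ finrank T`, then no nonzero vector of `V` is orthogonal to
`T`: `P_V` is injective on `T` (a vector of `T` orthogonal to `V` is at squared distance `≥ ‖φ‖²`
from `V`), so `P_V T ≤ V` has dimension `dim T ≥ dim V` and equals `V`; and `ψ = P_V φ` gives
`⟨φ, ψ⟩ = ‖ψ‖² ≠ 0`. [folklore] -/
theorem cover_of_close_of_finrank_le (T V : Submodule ℂ (n → ℂ)) {ε : ℝ} (hε : ε < 1)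
    (hclose : ∀ φ ∈ T, ∃ ψ ∈ V, (star (φ - ψ) ⬝ᵥ (φ - ψ)).re ≤ ε * (star φ ⬝ᵥ φ).re)
    (hdim : Module.finrank ℂ V ≤ Module.finrank ℂ T) :
    ∀ ψ ∈ V, ψ ≠ 0 → ∃ φ ∈ T, star φ ⬝ᵥ ψ ≠ 0 := by
  intro ψ₀ hψ₀V hψ₀
  by_contra hcon
  simp only [not_exists, not_and, not_not] at hcon
  -- transport along `EuclideanSpace ℂ n ≃ₗ (n → ℂ)`
  let eqv : EuclideanSpace ℂ n ≃ₗ[ℂ] (n → ℂ) := WithLp.linearEquiv 2 ℂ (n → ℂ)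
  let V' : Submodule ℂ (EuclideanSpace ℂ n) :=
    V.comap (eqv : EuclideanSpace ℂ n →ₗ[ℂ] (n → ℂ))
  let T' : Submodule ℂ (EuclideanSpace ℂ n) :=
    T.comap (eqv : EuclideanSpace ℂ n →ₗ[ℂ] (n → ℂ))
  have hmV : ∀ y, y ∈ V' ↔ ofLp y ∈ V := fun _ => Submodule.mem_comap
  have hmT : ∀ y, y ∈ T' ↔ ofLp y ∈ T := fun _ => Submodule.mem_comap
  have hfinV : Module.finrank ℂ V' = Module.finrank ℂ V := by
    show Module.finrank ℂ (V.comap (eqv : EuclideanSpace ℂ n →ₗ[ℂ] (n → ℂ))) = _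
    rw [Submodule.comap_equiv_eq_map_symm, LinearEquiv.finrank_map_eq]
  have hfinT : Module.finrank ℂ T' = Module.finrank ℂ T := by
    show Module.finrank ℂ (T.comap (eqv : EuclideanSpace ℂ n →ₗ[ℂ] (n → ℂ))) = _
    rw [Submodule.comap_equiv_eq_map_symm, LinearEquiv.finrank_map_eq]
  -- `P_V y = 0` means `y ⊥ V`
  have hperp : ∀ y : EuclideanSpace ℂ n, V'.starProjection y = 0 →
      ∀ v ∈ V, star v ⬝ᵥ ofLp y = 0 := by
    intro y hy v hv
    have hv' : (toLp 2 v : EuclideanSpace ℂ n) ∈ V' := (hmV _).2 hv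
    have h : ⟪(toLp 2 v : EuclideanSpace ℂ n), y⟫_ℂ = 0 := by
      rw [← Submodule.starProjection_eq_self_iff.mpr hv',
        Submodule.inner_starProjection_left_eq_right, hy, inner_zero_right]
    rwa [EuclideanSpace.inner_eq_star_dotProduct, ofLp_toLp, dotProduct_comm] at h
  -- `P_V` restricted to `T'` is injective
  let f : T' →ₗ[ℂ] EuclideanSpace ℂ n :=
    (V'.starProjection : EuclideanSpace ℂ n →L[ℂ] EuclideanSpace ℂ n).toLinearMap ∘ₗ T'.subtype
  have hf : ∀ x : T', f x = V'.starProjection (x : EuclideanSpace ℂ n) := fun _ => rfl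
  have hinj : Function.Injective f := by
    refine LinearMap.ker_eq_bot.mp (LinearMap.ker_eq_bot'.mpr fun x hx => ?_)
    have hxT : ofLp (x : EuclideanSpace ℂ n) ∈ T := (hmT _).1 x.2
    obtain ⟨ψ, hψV, hψ⟩ := hclose _ hxT
    have h1 : star ψ ⬝ᵥ ofLp (x : EuclideanSpace ℂ n) = 0 :=
      hperp _ (by rw [← hf]; exact hx) ψ hψV
    have horth : (star (ofLp (x : EuclideanSpace ℂ n)) ⬝ᵥ (-ψ)).re = 0 := by
      rw [dotProduct_neg, star_dotProduct, h1, star_zero, neg_zero, Complex.zero_re]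
    have hpy := re_add_self_of_orthogonal (ofLp (x : EuclideanSpace ℂ n)) (-ψ) horth
    rw [← sub_eq_add_neg] at hpy
    have hψnn := (Complex.nonneg_iff.mp (dotProduct_star_self_nonneg (-ψ))).1
    have hxnn := Complex.nonneg_iff.mp
      (dotProduct_star_self_nonneg (ofLp (x : EuclideanSpace ℂ n)))
    have hre : (star (ofLp (x : EuclideanSpace ℂ n)) ⬝ᵥ
        ofLp (x : EuclideanSpace ℂ n)).re = 0 := by
      nlinarith [hxnn.1]
    have hx0 : ofLp (x : EuclideanSpace ℂ n) = 0 :=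
      dotProduct_star_self_eq_zero.1
        (Complex.ext (by simpa using hre) (by simpa using hxnn.2.symm))
    apply Subtype.ext
    show (x : EuclideanSpace ℂ n) = 0
    calc (x : EuclideanSpace ℂ n) = toLp 2 (ofLp (x : EuclideanSpace ℂ n)) := rfl
      _ = 0 := by rw [hx0, toLp_zero]
  -- dimension count: `range f = V'`
  have hrange : LinearMap.range f ≤ V' := by
    rintro _ ⟨x, rfl⟩
    exact V'.starProjection_apply_mem _
  have hVle : Module.finrank ℂ V' ≤ Module.finrank ℂ (LinearMap.range f) := by
    rw [LinearMap.finrank_range_of_inj hinj, hfinT, hfinV]; exact hdim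
  have hEq : LinearMap.range f = V' := Submodule.eq_of_le_of_finrank_le hrange hVle
  have hψ₀' : (toLp 2 ψ₀ : EuclideanSpace ℂ n) ∈ LinearMap.range f := by
    rw [hEq]; exact (hmV _).2 hψ₀V
  obtain ⟨x, hx⟩ := LinearMap.mem_range.mp hψ₀'
  have h0 : star (ofLp (x : EuclideanSpace ℂ n)) ⬝ᵥ ψ₀ = 0 := hcon _ ((hmT _).1 x.2)
  have key : ⟪(x : EuclideanSpace ℂ n), toLp 2 ψ₀⟫_ℂ =
      ⟪(toLp 2 ψ₀ : EuclideanSpace ℂ n), toLp 2 ψ₀⟫_ℂ := by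
    calc ⟪(x : EuclideanSpace ℂ n), toLp 2 ψ₀⟫_ℂ
        = ⟪(x : EuclideanSpace ℂ n), V'.starProjection (toLp 2 ψ₀)⟫_ℂ := by
          rw [Submodule.starProjection_eq_self_iff.mpr ((hmV _).2 hψ₀V)]
      _ = ⟪V'.starProjection (x : EuclideanSpace ℂ n), toLp 2 ψ₀⟫_ℂ :=
          (Submodule.inner_starProjection_left_eq_right V' _ _).symm
      _ = ⟪(toLp 2 ψ₀ : EuclideanSpace ℂ n), toLp 2 ψ₀⟫_ℂ := by rw [← hf, hx]
  rw [EuclideanSpace.inner_eq_star_dotProduct, EuclideanSpace.inner_eq_star_dotProduct, ofLp_toLp,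
    dotProduct_comm ψ₀, dotProduct_comm ψ₀, h0] at key
  exact hψ₀ (dotProduct_star_self_eq_zero.1 key.symm)

end Abstract

/-- **The summit from trial subspaces and a degeneracy bound.** If for some `U > 0`,
`δ ∈ (0,1/2)`, `c > 0`, `ε < 1` with `1600ε ≤ c`, and `L₀`, at every even side `L = n+1 ≥ L₀` —
with `H = hubbardTorus 2 L 1 U` and the sector `(2⌊(1-δ)L²/2⌋, S^z = 0)` — there is a trial
subspace `T` with: (ORDER) `cL⁴‖φ‖² ≤ re⟨φ, (√2Δ_d)†(√2Δ_d)φ⟩` on `T`; (CLOSENESS) every `φ ∈ T`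
is within squared distance `ε‖φ‖²` of some sector ground state or of `0`; (DEGENERACY) every
linearly independent family of sector ground states has at most `finrank T` members — then
`HubbardSuperconductivity`. COVER of `hubbardSuperconductivity_iff_closeTrialSubspaces` is
derived from the count by `cover_of_close_of_finrank_le`. [this work] -/
theorem hubbardSuperconductivity_of_trialSubspaces_degeneracy
    (h : ∃ U : ℝ, 0 < U ∧ ∃ δ ∈ Set.Ioo (0 : ℝ) (1 / 2), ∃ c : ℝ, 0 < c ∧ ∃ ε : ℝ,
      1600 * ε ≤ c ∧ ε < 1 ∧ ∃ L₀ : ℕ, ∀ n : ℕ, Even (n + 1) → L₀ ≤ n + 1 →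
        ∃ T : Submodule ℂ (Fock (Orb (FermionTorus 2 (n + 1)))),
          (∀ φ ∈ T, c * ((n + 1 : ℕ) : ℝ) ^ 4 * (star φ ⬝ᵥ φ).re ≤ (expect
            ((pairField dWaveFormFactor (n + 1))ᴴ * pairField dWaveFormFactor (n + 1)) φ).re) ∧
          (∀ φ ∈ T, ∃ ψ, (ψ = 0 ∨ IsGroundStateInSector (hubbardTorus 2 (n + 1) 1 U)
              (2 * ⌊(1 - δ) * ((n + 1 : ℕ) : ℝ) ^ 2 / 2⌋₊) 0 ψ) ∧
            (star (φ - ψ) ⬝ᵥ (φ - ψ)).re ≤ ε * (star φ ⬝ᵥ φ).re) ∧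
          (∀ (k : ℕ) (f : Fin k → Fock (Orb (FermionTorus 2 (n + 1)))),
            LinearIndependent ℂ f →
            (∀ i, IsGroundStateInSector (hubbardTorus 2 (n + 1) 1 U)
              (2 * ⌊(1 - δ) * ((n + 1 : ℕ) : ℝ) ^ 2 / 2⌋₊) 0 (f i)) →
            k ≤ Module.finrank ℂ T)) :
    HubbardSuperconductivity := by
  obtain ⟨U, hU, δ, hδ, c, hc, ε, hεc, hε1, L₀, hb⟩ := h
  refine hubbardSuperconductivity_iff_closeTrialSubspaces.mpr
    ⟨U, hU, δ, hδ, c, hc, L₀, fun n hn hL => ?_⟩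
  obtain ⟨T, hord, hclose, hdeg⟩ := hb n hn hL
  set H := hubbardTorus 2 (n + 1) 1 U
  set N : ℕ := 2 * ⌊(1 - δ) * ((n + 1 : ℕ) : ℝ) ^ 2 / 2⌋₊ with hN
  -- the ground eigenspace of the sector
  let V : Submodule ℂ (Fock (Orb (FermionTorus 2 (n + 1)))) :=
    { carrier := {ψ | ψ ∈ szSector N 0 ∧ H *ᵥ ψ = ((H.minEnergyOn (szSector N 0) : ℝ) : ℂ) • ψ}
      zero_mem' := by simp
      add_mem' := by
        rintro x y ⟨hxS, hx⟩ ⟨hyS, hy⟩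
        exact ⟨Submodule.add_mem _ hxS hyS, by rw [mulVec_add, hx, hy, smul_add]⟩
      smul_mem' := by
        rintro a x ⟨hxS, hx⟩
        exact ⟨Submodule.smul_mem _ a hxS, by rw [mulVec_smul, hx, smul_comm]⟩ }
  have hmem : ∀ ψ, ψ ∈ V ↔
      ψ ∈ szSector N 0 ∧ H *ᵥ ψ = ((H.minEnergyOn (szSector N 0) : ℝ) : ℂ) • ψ :=
    fun _ => Iff.rfl
  have hGS : ∀ ψ, IsGroundStateInSector H N 0 ψ ↔ ψ ∈ V ∧ ψ ≠ 0 := fun ψ =>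
    ⟨fun h => ⟨(hmem ψ).2 ⟨h.1, h.2.2⟩, h.2.1⟩,
      fun h => ⟨((hmem ψ).1 h.1).1, h.2, ((hmem ψ).1 h.1).2⟩⟩
  -- metric closeness to `V`
  have hclose' : ∀ φ ∈ T, ∃ ψ ∈ V, (star (φ - ψ) ⬝ᵥ (φ - ψ)).re ≤ ε * (star φ ⬝ᵥ φ).re := by
    intro φ hφ
    obtain ⟨ψ, hψ, hle⟩ := hclose φ hφ
    rcases hψ with rfl | hgs
    · exact ⟨0, V.zero_mem, hle⟩
    · exact ⟨ψ, ((hGS ψ).1 hgs).1, hle⟩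
  -- degeneracy: `finrank V ≤ finrank T`, via a basis of `V`
  have hdim : Module.finrank ℂ V ≤ Module.finrank ℂ T := by
    let b := Module.finBasis ℂ V
    have hli : LinearIndependent ℂ (fun i => (b i : Fock (Orb (FermionTorus 2 (n + 1))))) :=
      b.linearIndependent.map' V.subtype V.ker_subtype
    exact hdeg _ _ hli fun i => (hGS _).2 ⟨(b i).2, fun h0 => b.ne_zero i (Subtype.ext h0)⟩
  have hcover := cover_of_close_of_finrank_le T V hε1 hclose' hdim
  refine ⟨T, hord, fun ψ hgs => hcover ψ ((hGS ψ).1 hgs).1 hgs.2.1, fun φ hφ u hu hw => ?_⟩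
  obtain ⟨ψ, hψV, hle⟩ := hclose' φ hφ
  have horth : ∀ v ∈ V, star v ⬝ᵥ (φ - u) = 0 := by
    intro v hv
    by_cases hv0 : v = 0
    · rw [hv0, star_zero, zero_dotProduct]
    · exact hw v ((hGS v).2 ⟨hv, hv0⟩)
  have hnn := (Complex.nonneg_iff.mp (dotProduct_star_self_nonneg φ)).1
  calc (star (φ - u) ⬝ᵥ (φ - u)).re ≤ (star (φ - ψ) ⬝ᵥ (φ - ψ)).re :=
        orthogonal_residual_le V ((hGS u).1 hu).1 hψV horth
    _ ≤ ε * (star φ ⬝ᵥ φ).re := hle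
    _ ≤ c / 1600 * (star φ ⬝ᵥ φ).re := mul_le_mul_of_nonneg_right (by linarith) hnn

end Summit.HubbardSuperconductivity.HubbardSuperconductivity.Theorems
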